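/-
  SoloInformedSumCurrency.lean — solo-ABC-informed, session 14 (2026-08-19).

  THEOREM H (paper §2.2 (iii), made quantitative; the remark "sum currency: free generically"
  is CORRECTED by it).  THE PLANTED RELATION SKEWS THE RELATION LATTICE.

  Setting (as in Theorem G, `SoloInformedProductCurrency.lean`).  `p` is an odd prime dividing
  `c = a + b`, `u₀, …, u_{n-1} ∈ (ℤ/p)ˣ` the residues of the primes `q₀, …, q_{n-1}` of `ab`,
  `G_p = ⟨u_i⟩`, `g = |G_p|`, and `L_p = {x ∈ ℤⁿ : ∏ u_i ^ x_i = 1}` the relation lattice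
  (index `g`).  Theorem G: `n` independent relations `V₀, …, V_{n-1}` (the exponent vectors of a
  system of multiplicatively independent PRINCIPAL-unit generators `η_j = ∏ q_i ^ (V j i)`) have
  `(log 2)^n · g ≤ n! · ∏_j h_j` for any `h_j ≥ ‖V j‖_∞ · log 2` — the PRODUCT of the heights pays
  `g`.  In the conjectural SUM currency (a bound `C(n) · (h(η₀) + … + h(η_{n-1})) · log B`, the
  Lang–Waldschmidt shape) the report said the cost is the last successive minimum `λ_n(L_p)`,
  "≍ n · g^{1/n} for well-rounded `L_p`, ≍ g in the worst case".  What it missed: `L_p` is NEVER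
  well-rounded at a large prime of `c`, because abc PLANTS a short relation in it —
  `a ≡ -b (mod p)` gives `(a/b)² ≡ 1`, i.e. the vector `x₀ = 2·(v_{q_i}(a) − v_{q_i}(b))_i ∈ L_p`,
  `x₀ ≠ 0`, `‖x₀‖_∞ ≤ 2 log₂ c` (`soloInformed_planted_relation_sq`,
  `soloInformed_padicValNat_mul_log_two_le_log`).  THEOREM H: if `x₀ ∈ L_p` is a non-zero
  relation with `‖x₀‖_∞ ≤ R`, then for every non-singular system of relations `V` there is a row
  `j` with

        (log 2)^n · g ≤ n! · (R · log 2) · ∏_{i ≠ j} h_i ,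

  hence `(log 2)^n · g ≤ n! · (R · log 2) · M^(n-1)` whenever all `h_i ≤ M`: the LARGEST height of
  any independent system of principal-unit generators is `≥ log 2 · (g/(n!·R))^{1/(n-1)}`, and so
  is their sum.  For `n = 2` (two primes in `ab`) the sum currency pays `g·log 2/(2R)` — the full
  residue-torsion factor up to `log c` — and for bounded `n = ω(ab)` it pays `g^{1/(n-1)}`, never
  the "generic" `g^{1/n}`: Baker–Wüstholz's face (ii) would open door (B-i) only for
  `n ≳ log g / log log c`.  (Generically, i.e. barring further short relations among the
  `u_i`, `λ_2 ≍ … ≍ λ_n ≍ (g/R)^{1/(n-1)}` and the floor is attained; the worst case `λ_n ≍ g`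
  remains possible.)

  Proof.  CRAMER EXCHANGE (`soloInformed_exists_det_updateRow_ne_zero`): since
  `Vᵀ *ᵥ cramer Vᵀ x₀ = det V • x₀ ≠ 0`, some `cramer Vᵀ x₀ j = det (V.updateRow j x₀)` is
  non-zero; the matrix `V.updateRow j x₀` is again a non-singular system of relations, and
  Theorem G (`soloInformed_productCurrency_closure`) applied to it with the height `R · log 2` in
  row `j` is the displayed inequality.

  Scope, honestly: a theorem about integer matrices and cyclic groups plus the two-line abc
  dictionary (`a² ≡ b² (mod p)` for `p ∣ a + b`; `v_q(a) · log 2 ≤ log a`); it quantifies one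
  sentence of the sharpest-statement report (§2.2 (iii)) and says nothing about abc itself.
  Mathlib + Theorem G; standard axioms.
-/
import Summits.ABC.ABC.Theorems.SoloInformedProductCurrency

open Finset Matrix

namespace Summit.ABC.ABC.Theorems

/-! ### Cramer exchange: a non-zero vector can replace some row of a non-singular matrix -/

/-- If `det V ≠ 0` and `x₀ ≠ 0` (over `ℤ`), then for some row index `j` the matrix obtained by
replacing row `j` of `V` with `x₀` is still non-singular.  (Cramer: the vector of these
determinants is `cramer Vᵀ x₀`, and `Vᵀ *ᵥ cramer Vᵀ x₀ = det V • x₀`.) -/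
theorem soloInformed_exists_det_updateRow_ne_zero {n : ℕ} (V : Matrix (Fin n) (Fin n) ℤ)
    (hdet : V.det ≠ 0) (x₀ : Fin n → ℤ) (hx₀ : x₀ ≠ 0) :
    ∃ j, (V.updateRow j x₀).det ≠ 0 := by
  by_contra hall
  push Not at hall
  have hcr : Matrix.cramer Vᵀ x₀ = 0 := by
    funext j
    rw [Matrix.cramer_transpose_apply, hall j, Pi.zero_apply]
  have hmul : Vᵀ.det • x₀ = 0 := by
    rw [← Matrix.mulVec_cramer, hcr, Matrix.mulVec_zero]
  rw [Matrix.det_transpose] at hmul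
  rcases smul_eq_zero.mp hmul with h | h
  · exact hdet h
  · exact hx₀ h

/-! ### Theorem H, abstract-lattice form -/

/-- THEOREM H, abstract rows.  If the `d_i` generate `ℤ/g` (Bézout form), every row of the
non-singular integer matrix `V` lies in the lattice `{x : g ∣ ∑ x_i d_i}`, the NON-ZERO vector `x₀`
lies in it too with `|x₀ i| ≤ R`, and `h_j ≥ |V j i| · log 2`, then for some row `j`,
`(log 2)^n · g ≤ n! · (R · log 2) · ∏_{i ≠ j} h_i`. -/
theorem soloInformed_sumCurrency {n : ℕ} (g : ℕ) (d : Fin n → ℤ)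
    (hgen : ∃ c : Fin n → ℤ, ∃ c₀ : ℤ, ∑ i, c i * d i + c₀ * (g : ℤ) = 1)
    (V : Matrix (Fin n) (Fin n) ℤ) (hV : ∀ j, (g : ℤ) ∣ ∑ i, V j i * d i) (hdet : V.det ≠ 0)
    (x₀ : Fin n → ℤ) (hx₀L : (g : ℤ) ∣ ∑ i, x₀ i * d i) (hx₀ : x₀ ≠ 0)
    (R : ℝ) (hR : ∀ i, (|x₀ i| : ℝ) ≤ R)
    (h : Fin n → ℝ) (hh : ∀ j i, (|V j i| : ℝ) * Real.log 2 ≤ h j) :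
    ∃ j, (Real.log 2) ^ n * (g : ℝ) ≤
      (n.factorial : ℝ) * ((R * Real.log 2) * ∏ i ∈ univ.erase j, h i) := by
  obtain ⟨j, hj⟩ := soloInformed_exists_det_updateRow_ne_zero V hdet x₀ hx₀
  refine ⟨j, ?_⟩
  have hlog2 : 0 < Real.log 2 := Real.log_pos one_lt_two
  -- the exchanged matrix is again a system of lattice rows
  have hW : ∀ k, (g : ℤ) ∣ ∑ i, (V.updateRow j x₀) k i * d i := by
    intro k
    by_cases hk : k = j
    · subst hk
      simpa [Matrix.updateRow_self] using hx₀L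
    · simpa [Matrix.updateRow_ne hk] using hV k
  -- heights: `R · log 2` in row `j`, `h k` elsewhere
  have hh' : ∀ k i, (|(V.updateRow j x₀) k i| : ℝ) * Real.log 2 ≤ Function.update h j (R * Real.log 2) k := by
    intro k i
    by_cases hk : k = j
    · subst hk
      simp only [Matrix.updateRow_self, Function.update_self]
      exact mul_le_mul_of_nonneg_right (hR i) hlog2.le
    · simp only [Matrix.updateRow_ne hk, Function.update_of_ne hk]
      exact hh k i
  have key := soloInformed_productCurrency g d hgen (V.updateRow j x₀) hW hj
    (Function.update h j (R * Real.log 2)) hh'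
  rwa [Finset.prod_update_of_mem (Finset.mem_univ j), Finset.sdiff_singleton_eq_erase] at key

/-! ### Theorem H, intrinsic form in a commutative cyclic group -/

/-- THEOREM H, intrinsic form.  In a commutative CYCLIC group (e.g. `(ZMod p)ˣ`): if the rows of
the non-singular integer matrix `V` are relations `∏_i u_i ^ (V j i) = 1`, `x₀ ≠ 0` is a relation
`∏_i u_i ^ (x₀ i) = 1` with `|x₀ i| ≤ R`, and `h_j ≥ |V j i| · log 2`, then for some row `j`,
`(log 2)^n · |⟨u_0, …, u_{n-1}⟩| ≤ n! · (R · log 2) · ∏_{i ≠ j} h_i`. -/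
theorem soloInformed_sumCurrency_closure {G : Type*} [CommGroup G] [IsCyclic G] {n : ℕ}
    (u : Fin n → G) (V : Matrix (Fin n) (Fin n) ℤ) (hV : ∀ j, ∏ i, u i ^ V j i = 1)
    (hdet : V.det ≠ 0) (x₀ : Fin n → ℤ) (hx₀rel : ∏ i, u i ^ x₀ i = 1) (hx₀ : x₀ ≠ 0)
    (R : ℝ) (hR : ∀ i, (|x₀ i| : ℝ) ≤ R)
    (h : Fin n → ℝ) (hh : ∀ j i, (|V j i| : ℝ) * Real.log 2 ≤ h j) :
    ∃ j, (Real.log 2) ^ n * (Nat.card (Subgroup.closure (Set.range u)) : ℝ) ≤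
      (n.factorial : ℝ) * ((R * Real.log 2) * ∏ i ∈ univ.erase j, h i) := by
  obtain ⟨j, hj⟩ := soloInformed_exists_det_updateRow_ne_zero V hdet x₀ hx₀
  refine ⟨j, ?_⟩
  have hlog2 : 0 < Real.log 2 := Real.log_pos one_lt_two
  have hW : ∀ k, ∏ i, u i ^ (V.updateRow j x₀) k i = 1 := by
    intro k
    by_cases hk : k = j
    · subst hk
      simpa [Matrix.updateRow_self] using hx₀rel
    · simpa [Matrix.updateRow_ne hk] using hV k
  have hh' : ∀ k i, (|(V.updateRow j x₀) k i| : ℝ) * Real.log 2 ≤ Function.update h j (R * Real.log 2) k := by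
    intro k i
    by_cases hk : k = j
    · subst hk
      simp only [Matrix.updateRow_self, Function.update_self]
      exact mul_le_mul_of_nonneg_right (hR i) hlog2.le
    · simp only [Matrix.updateRow_ne hk, Function.update_of_ne hk]
      exact hh k i
  have key := soloInformed_productCurrency_closure u (V.updateRow j x₀) hW hj
    (Function.update h j (R * Real.log 2)) hh'
  rwa [Finset.prod_update_of_mem (Finset.mem_univ j), Finset.sdiff_singleton_eq_erase] at key

/-- THEOREM H, max form: with a uniform bound `h_i ≤ M` on the heights,
`(log 2)^n · |⟨u_i⟩| ≤ n! · (R · log 2) · M^(n-1)`; i.e. the largest height of an independent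
system of principal-unit generators is at least `log 2 · (|⟨u_i⟩| / (n! · R))^{1/(n-1)}`. -/
theorem soloInformed_sumCurrency_max {G : Type*} [CommGroup G] [IsCyclic G] {n : ℕ}
    (u : Fin n → G) (V : Matrix (Fin n) (Fin n) ℤ) (hV : ∀ j, ∏ i, u i ^ V j i = 1)
    (hdet : V.det ≠ 0) (x₀ : Fin n → ℤ) (hx₀rel : ∏ i, u i ^ x₀ i = 1) (hx₀ : x₀ ≠ 0)
    (R : ℝ) (hR : ∀ i, (|x₀ i| : ℝ) ≤ R)
    (h : Fin n → ℝ) (hh : ∀ j i, (|V j i| : ℝ) * Real.log 2 ≤ h j)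
    (M : ℝ) (hM : ∀ j, h j ≤ M) :
    (Real.log 2) ^ n * (Nat.card (Subgroup.closure (Set.range u)) : ℝ) ≤
      (n.factorial : ℝ) * ((R * Real.log 2) * M ^ (n - 1)) := by
  obtain ⟨j, hj⟩ := soloInformed_sumCurrency_closure u V hV hdet x₀ hx₀rel hx₀ R hR h hh
  have hlog2 : 0 < Real.log 2 := Real.log_pos one_lt_two
  have hR0 : 0 ≤ R := (abs_nonneg _).trans (hR j) |>.trans_eq' (by simp)
  have h0 : ∀ i, 0 ≤ h i := fun i => le_trans (by positivity) (hh i j)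
  have hprod : ∏ i ∈ univ.erase j, h i ≤ M ^ (n - 1) := by
    calc ∏ i ∈ univ.erase j, h i ≤ ∏ _i ∈ univ.erase j, M :=
          Finset.prod_le_prod (fun i _ => h0 i) (fun i _ => hM i)
      _ = M ^ (n - 1) := by
          rw [Finset.prod_const, Finset.card_erase_of_mem (Finset.mem_univ j),
            Finset.card_univ, Fintype.card_fin]
  refine hj.trans ?_
  have hRl : 0 ≤ R * Real.log 2 := mul_nonneg hR0 hlog2.le
  exact mul_le_mul_of_nonneg_left (mul_le_mul_of_nonneg_left hprod hRl) (Nat.cast_nonneg _)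

/-! ### The abc dictionary: the planted relation and its height -/

/-- The PLANTED relation: if `p ∣ a + b` then `a² = b²` in `ZMod p` (so, at a prime `p ∣ c` of an
abc triple, `(a/b)² = ∏ q_i ^ (2 (v_{q_i}(a) − v_{q_i}(b)))` is a relation `≡ 1` among the residues of
the primes `q_i` of `ab`). -/
theorem soloInformed_planted_relation_sq (a b p : ℕ) (hp : p ∣ a + b) :
    ((a : ZMod p)) ^ 2 = ((b : ZMod p)) ^ 2 := by
  have hab : ((a : ZMod p)) + (b : ZMod p) = 0 := by
    have : (((a + b : ℕ)) : ZMod p) = 0 := (ZMod.natCast_eq_zero_iff (a + b) p).mpr hp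
    simpa using this
  have ha : (a : ZMod p) = -(b : ZMod p) := eq_neg_of_add_eq_zero_left hab
  rw [ha, neg_sq]

/-- Units form of the planted relation: for a prime `p ∣ a + b` with `p ∤ b` (as for an abc triple,
`gcd(b, c) = 1`), the unit `ā · b̄⁻¹` of `ZMod p` satisfies `(ā b̄⁻¹)² = 1`. -/
theorem soloInformed_planted_relation_unit (a b p : ℕ) [Fact p.Prime] (hp : p ∣ a + b)
    (hb : ¬ p ∣ b) :
    ((a : ZMod p) * (b : ZMod p)⁻¹) ^ 2 = 1 := by
  have hb0 : (b : ZMod p) ≠ 0 := by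
    rwa [Ne, ZMod.natCast_eq_zero_iff]
  rw [mul_pow, soloInformed_planted_relation_sq a b p hp, inv_pow,
    mul_inv_cancel₀ (pow_ne_zero 2 hb0)]

/-- Height of the planted relation: `v_q(a) · log 2 ≤ log a` for a prime `q` and `a ≥ 1`
(so `‖x₀‖_∞ ≤ 2 log₂ c` for `x₀ = 2 (v_{q_i}(a) − v_{q_i}(b))_i`, since `a, b < c`). -/
theorem soloInformed_padicValNat_mul_log_two_le_log (q a : ℕ) (hq : q.Prime) (ha : 0 < a) :
    (padicValNat q a : ℝ) * Real.log 2 ≤ Real.log a := by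
  have hFact : Fact q.Prime := ⟨hq⟩
  have h1 : 2 ^ padicValNat q a ≤ q ^ padicValNat q a :=
    Nat.pow_le_pow_left hq.two_le _
  have h2 : q ^ padicValNat q a ≤ a := Nat.le_of_dvd ha pow_padicValNat_dvd
  have h3 : (2 : ℝ) ^ padicValNat q a ≤ (a : ℝ) := by exact_mod_cast h1.trans h2
  have h4 : Real.log ((2 : ℝ) ^ padicValNat q a) ≤ Real.log a :=
    Real.log_le_log (by positivity) h3
  rwa [Real.log_pow] at h4

end Summit.ABC.ABC.Theorems
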